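import Summits.RiemannHypothesis.RiemannHypothesis.Theorems.WeilSemilocalWallsTenKTwinOfUC
import Summits.RiemannHypothesis.RiemannHypothesis.Theorems.ThetaTier2BridgeUC
import HarnessLib

/-!
# Route `WeilSemilocal` — CLOSER of the crux `WallsTenKTwin` (item stmt-RiemannHypothesis-19172; RH-FREE)

FIN of the tier-2 theta certificate (twin class): for every twin prime `157 ≤ q < 10⁴` (`q + 2` prime) and every prime `q' > q`,
`a*(S_q) = weilSemilocalThreshold (Nat.primesBelow q) < (log q')/2`.  Composition:

* KERNEL SIDE (cc-s2-1 gen22/23): the checker `ThetaTier2Check` and its soundness chain `… ThetaTier2Sound.certify_sound`, the row layer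
  `ThetaTier2Row/RowEval/RowSound` (`Row2.check_sound : r.check = true → T2Valid r.inp r.real ∧ r.RowFacts`), the 13 data modules
  `ThetaTier2RowsTwin01…13` (all 193 twins, `decide +kernel`), coverage `ThetaTier2CoverTwin.twin_cover`, glue `ThetaTier2RowsTwinAll.exists_twin_row`,
  and `wallsTenKTwin_of_uc'` (p467970: twins are consecutive primes, `log` monotone);
* ANALYTIC SIDE (weil-1 gen21, cc-s2-3 gen23, tier2-p1/p2): E1–E5, `ucT2_of_bounds`, `ucT2Cheb_of_valid` (Chebyshev `ψ`, hypothesis-free),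
  the bridge `ThetaTier2Bridge`/`ThetaTier2BridgeUC` — `Row2.uc2_of_valid_five : T2Valid r.inp r.real → r.RowFacts → r.m = 5 →
  ConsecutivePrimes r.q r.qn → a*(S_{r.q}) < (log r.qn)/2` (constants `ZetaHyp 5`, `LambdaHyp 5` of `ThetaTier2Constants`).

No named fact, no Rosser–Schoenfeld; axioms standard.  UPPER clauses of truncated Weil forms only (LADDER-RH W-P(P2), cell `rh-explicit`);
nothing here bears on the truth of RH.
-/

set_option linter.dupNamespace false  -- the mandated namespace repeats `RiemannHypothesis`
set_option autoImplicit false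

namespace Summit.RiemannHypothesis.RiemannHypothesis.Theorems.WeilSemilocalRoute

open Summit.RiemannHypothesis.RiemannHypothesis.Theorems Summit.RiemannHypothesis.RiemannHypothesis.Theorems.ThetaTier2

/-- **CLOSER of the crux `WallsTenKTwin`** (item stmt-RiemannHypothesis-19172, `route-RiemannHypothesis-WeilSemilocal`): C-I(a) at every
twin prime `157 ≤ q < 10⁴`. [this cell; tier-2 theta certificate over 193 kernel rows, bridge `Row2.uc2_of_valid_five` (weil-1)] -/
theorem wallsTenKTwin_proof :
    Summit.RiemannHypothesis.RiemannHypothesis.Theses.WeilSemilocal.WallsTenKTwin :=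
  wallsTenKTwin_of_uc' fun _r hV hF hcons hm => Row2.uc2_of_valid_five hV hF hm hcons

end Summit.RiemannHypothesis.RiemannHypothesis.Theorems.WeilSemilocalRoute
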